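import Literature.AnabelianGeometry.SemiGraphs.TemperedSpecialFibreFullEmbeddingProofs
import Literature.AnabelianGeometry.SemiGraphs.TemperedCuspOmission
import HarnessLib

/-!
# [SemiAnbd] Example 3.10 (PRIMS p. 269 l. 18–28 = kurims p. 44): the graph of anabelioids `𝒢`
# "[without compact structure!]" and "a natural equivalence `B^temp(𝒢) ⥲ B^temp(𝒢^c)`" — PROOFS

Mochizuki, *Semi-graphs of anabelioids*, Publ. RIMS **42** (2006), Example 3.10, PRIMS pp. 268–270
(kurims manuscript pp. 43–45) [cite: MochizukiSemiAnbd2006, Ex 3.10 pp.43-45]: "`𝒢` (respectively,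
`𝒢^c`) the graph of anabelioids (respectively, semi-graph of anabelioids) determined by the semi-graph
of profinite groups [without compact structure!] (respectively, with compact structure) associated to
the geometric special fiber of the stable model of `X^log_K` … it follows from the definitions that we
have a natural equivalence `B^temp(𝒢) ⥲ B^temp(𝒢^c)` and a natural full embedding
`B^temp(𝒢) ↪ B^temp(Δ)`" (p. 269 l. 18–28), and "the natural quotient `Δ ↠ π₁^temp(𝒢) ≅ π₁^temp(𝒢^c)`"
(Cor. 3.11, proof, p. 48); Mochizuki, *Inter-universal Teichmüller theory I*, §2 p. 44 l. 28–30: "the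
omission of cuspidal edges clearly does not affect … the tempered … fundamental groups"
[cite: Mochizuki2012, §2 p.44].

PROOF-ONLY companion of the FROZEN interface files `TemperedSpecialFibre.lean` (`SpecialFibreData`,
abc-iut-L3-t2) and `TemperedSpecialFibreTower.lean` (`SpecialFibreTower`): no `def`, no `instance`, no
new `Prop`; nothing of the parent files is edited or restated (cell abc-iut, W6 row d068 = cone node
SemiAnbd:Ex3.10, per-node clause coverage; plan/L3/SUBDAG-SemiAnbd-Ex310.md row **X1**, so far
"recorded-not-typed: needs an open-edge-deletion operation on `ProfiniteSemiGraph`").  The interface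
records only `𝒢^c` (`SpecialFibreData.Gc`); the graph of anabelioids `𝒢` of print IS expressible with
the tree's vocabulary of row W4-30 (`SemiGraph.maximalSubgraph` — "the sub-semi-graph obtained by
omitting all of the open edges", [SemiAnbd] §1 p. 13; `ProfiniteSemiGraph.restrict`;
`SemiGraph.Subgraph.IsCuspOmission`): **`𝒢 := S.Gc.restrict S.Gc.graph.maximalSubgraph`** — `𝒢^c` with
its open edges (the cusps) deleted, same vertex and edge groups.  Kernel witnesses, BY NAME:

* `𝒢` is a GRAPH (every branch abuts), connected, with a vertex (`isGraph_graphOf`,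
  `isConnected_graphOf`, `hasVertex_graphOf`); deleting the cusps of `𝒢^c` is a cusp omission
  (`maximalSubgraph_isCuspOmission`: `𝒢^c` is connected with a vertex by `Thm37Hypotheses`, so it has
  no isolated edge — `SemiGraph.maximalSubgraph_isCuspOmission_of_isConnected`, row W4-30 part 1a);
* **"a natural equivalence `B^temp(𝒢) ⥲ B^temp(𝒢^c)`"**: the restriction functor
  `B^temp(𝒢^c) ⥤ B^temp(𝒢)` is an equivalence of categories (`isEquivalence_btempRestrict_graphOf`,
  `nonempty_btempCat_equivalence_graphOf`; `ProfiniteSemiGraph.isEquivalence_btempRestrict`, row W4-30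
  part 2, `TemperedCuspOmission.lean`);
* **"`π₁^temp(𝒢) ≅ π₁^temp(𝒢^c)`"** (p. 48): the chart group `π₁^temp(𝒢^c) = S.chart.G` is a tempered
  fundamental group of `𝒢` — `B^temp(𝒢) ≌ B^temp(π₁^temp(𝒢^c))` and a `TemperedPiChart` of `𝒢` with the
  SAME underlying topological group (`nonempty_btempCat_graphOf_equivalence_btemp`,
  `exists_temperedPiChart_graphOf_G_eq`);
* **"a natural full embedding `B^temp(𝒢) ↪ B^temp(Δ)`"** for `𝒢` itself (the parent proof file
  `TemperedSpecialFibreFullEmbeddingProofs.lean`, p432620, has it for `𝒢^c`): along any equivalence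
  `B^temp(𝒢) ≌ B^temp(𝒢^c)` the composite `B^temp(𝒢) ≌ B^temp(𝒢^c) ≌ B^temp(π₁^temp(𝒢^c)) ⥤ B^temp(Δ)`
  is full and faithful (`graphFullEmbedding_full` / `_faithful`, `exists_graphFullEmbedding`);
* the same at every level `i` of a special-fibre tower (`SpecialFibreTower.*_graphOf`, p. 269 l. 33 –
  p. 270 l. 26: "`𝒢_i` (respectively, `𝒢_i^c`)", "`Δ[i] ↠ π₁^temp(𝒢_i) ⋊ Δ_i`").

Refereed pre-IUT material (2006) and generic semi-graph bookkeeping; nothing here bears on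
[IUTchIII] Cor. 3.12; typed ≠ discharged for the origin-parametrised statements of Example 3.10
(`Ex310TowerStatement`, row T0, untouched).
-/

noncomputable section

namespace Literature.AnabelianGeometry.SemiGraphs

open CategoryTheory Topology ProfiniteSemiGraph

universe u

/-! ### `𝒢` := `𝒢^c` minus its open edges, for special-fibre data -/

namespace SpecialFibreData

variable {K : Type u} [Field K] {D : TemperedArithmeticGroup K} (S : SpecialFibreData D)

/-- `𝒢^c` has no isolated edge: it is connected with at least one vertex (hypotheses of Thm. 3.7,
field `hyp`). [cite: MochizukiSemiAnbd2006, Ex 3.10 p.44] -/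
theorem not_isIsolatedEdge_Gc (e : S.Gc.graph.Edge) : ¬ S.Gc.graph.IsIsolatedEdge e :=
  SemiGraph.not_isIsolatedEdge_of_isConnected S.hyp.isConnected S.hyp.hasVertex e

/-- Deleting the open edges (cusps) of `𝒢^c` — passing to "the graph of anabelioids `𝒢` [without
compact structure!]" — is a cusp omission: every vertex is kept and every deleted edge has exactly one
abutting branch ([SemiAnbd] §1 p. 13; Ex. 3.10 p. 44 "open edges … cusps").
[cite: MochizukiSemiAnbd2006, Ex 3.10 p.44] -/
theorem maximalSubgraph_isCuspOmission : S.Gc.graph.maximalSubgraph.IsCuspOmission :=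
  SemiGraph.maximalSubgraph_isCuspOmission_of_isConnected S.hyp.isConnected S.hyp.hasVertex

/-- `𝒢 = 𝒢^c|_{maximal subgraph}` is a GRAPH of anabelioids: every branch of each of its edges abuts
to a vertex ("graph of anabelioids (respectively, semi-graph of anabelioids)", p. 44).
[cite: MochizukiSemiAnbd2006, Ex 3.10 p.44] -/
theorem isGraph_graphOf : (S.Gc.restrict S.Gc.graph.maximalSubgraph).IsGraph :=
  SemiGraph.isGraph_maximalSubgraph S.Gc.graph

/-- `𝒢` is connected (omitting cusps preserves connectedness). [cite: MochizukiSemiAnbd2006, Ex 3.10 p.44] -/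
theorem isConnected_graphOf : (S.Gc.restrict S.Gc.graph.maximalSubgraph).IsConnected :=
  SemiGraph.isConnected_maximalSubgraph S.hyp.isConnected S.hyp.hasVertex

/-- `𝒢` has a vertex (the vertices of `𝒢` are those of `𝒢^c`). [cite: MochizukiSemiAnbd2006, Ex 3.10 p.44] -/
theorem hasVertex_graphOf : (S.Gc.restrict S.Gc.graph.maximalSubgraph).HasVertex := by
  obtain ⟨v⟩ := S.hyp.hasVertex
  exact ⟨S.maximalSubgraph_isCuspOmission.vtx v⟩

/-- The vertex groups of `𝒢` are those of `𝒢^c` (definitional: "determined by the [same] semi-graph of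
profinite groups", p. 44). [cite: MochizukiSemiAnbd2006, Ex 3.10 p.44] -/
theorem graphOf_Gv (v : (S.Gc.restrict S.Gc.graph.maximalSubgraph).graph.Vertex) :
    (S.Gc.restrict S.Gc.graph.maximalSubgraph).Gv v = S.Gc.Gv v.1 := rfl

/-! ### "a natural equivalence `B^temp(𝒢) ⥲ B^temp(𝒢^c)`" (p. 269 l. 25–27) -/

/-- **"we have a natural equivalence `B^temp(𝒢) ⥲ B^temp(𝒢^c)`"** ([SemiAnbd] Ex. 3.10, PRIMS p. 269
l. 25–27): the restriction functor `B^temp(𝒢^c) ⥤ B^temp(𝒢)` (forget the fibres over the cusps) is an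
equivalence of categories — omission of cuspidal edges does not change `B^temp` ([IUTchI] §2 p. 44).
[cite: MochizukiSemiAnbd2006, Ex 3.10 p.44] -/
theorem isEquivalence_btempRestrict_graphOf :
    (S.Gc.btempRestrict S.Gc.graph.maximalSubgraph).IsEquivalence :=
  ProfiniteSemiGraph.isEquivalence_btempRestrict S.maximalSubgraph_isCuspOmission

/-- `B^temp(𝒢^c) ≌ B^temp(𝒢)` as an (anonymous) equivalence of categories.
[cite: MochizukiSemiAnbd2006, Ex 3.10 p.44] -/
theorem nonempty_btempCat_equivalence_graphOf :
    Nonempty (BTempCat S.Gc ≌ BTempCat (S.Gc.restrict S.Gc.graph.maximalSubgraph)) :=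
  ProfiniteSemiGraph.nonempty_btempCat_equivalence S.maximalSubgraph_isCuspOmission

/-! ### "`π₁^temp(𝒢) ≅ π₁^temp(𝒢^c)`" (Cor. 3.11, proof, p. 48) -/

/-- **`π₁^temp(𝒢) ≅ π₁^temp(𝒢^c)`**, temperoid form: the tempered fundamental group `π₁^temp(𝒢^c)` of
the chart (Prop. 3.6 (ii)) is a tempered fundamental group of `𝒢`:
`B^temp(𝒢) ≌ B^temp(π₁^temp(𝒢^c))`. [cite: MochizukiSemiAnbd2006, Cor 3.11 p.48] -/
theorem nonempty_btempCat_graphOf_equivalence_btemp :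
    Nonempty (BTempCat (S.Gc.restrict S.Gc.graph.maximalSubgraph) ≌ BTemp S.chart.G) :=
  ProfiniteSemiGraph.nonempty_btempCat_restrict_equivalence_btemp S.maximalSubgraph_isCuspOmission
    S.chart

/-- **`π₁^temp(𝒢) ≅ π₁^temp(𝒢^c)`**, chart form: there is a tempered fundamental group chart of `𝒢`
whose underlying topological group IS `π₁^temp(𝒢^c)` (transport of the chart of `𝒢^c` along
`B^temp(𝒢) ≌ B^temp(𝒢^c)`); in particular the admissible quotient `Δ ↠ π₁^temp(𝒢^c)` is at the same
time "the natural quotient `Δ ↠ π₁^temp(𝒢)`" (p. 48). [cite: MochizukiSemiAnbd2006, Cor 3.11 p.48] -/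
theorem exists_temperedPiChart_graphOf_G_eq :
    ∃ c : TemperedPiChart (S.Gc.restrict S.Gc.graph.maximalSubgraph), c.G = S.chart.G :=
  ProfiniteSemiGraph.exists_temperedPiChart_restrict_G_eq S.maximalSubgraph_isCuspOmission S.chart

/-! ### "a natural full embedding `B^temp(𝒢) ↪ B^temp(Δ)`" for `𝒢` itself (p. 269 l. 27–28) -/

/-- **"a natural full embedding `B^temp(𝒢) ↪ B^temp(Δ)`"** ([SemiAnbd] Ex. 3.10, PRIMS p. 269 l. 27–28)
for the graph of anabelioids `𝒢` WITHOUT compact structure: along any equivalence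
`e : B^temp(𝒢) ≌ B^temp(𝒢^c)`, the composite `B^temp(𝒢) ≌ B^temp(𝒢^c) ≌ B^temp(π₁^temp(𝒢^c)) ⥤ B^temp(Δ)`
(chart, then pull-back along the admissible quotient `Δ ↠ π₁^temp(𝒢^c)`) is FULL.
[cite: MochizukiSemiAnbd2006, Ex 3.10 p.44] -/
theorem graphFullEmbedding_full
    (e : BTempCat (S.Gc.restrict S.Gc.graph.maximalSubgraph) ≌ BTempCat S.Gc) :
    (e.functor ⋙ S.chart.equiv.functor ⋙ BTemp.res S.admissible).Full := by
  haveI := S.fullEmbedding_full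
  infer_instance

/-- … and FAITHFUL. [cite: MochizukiSemiAnbd2006, Ex 3.10 p.44] -/
theorem graphFullEmbedding_faithful
    (e : BTempCat (S.Gc.restrict S.Gc.graph.maximalSubgraph) ≌ BTempCat S.Gc) :
    (e.functor ⋙ S.chart.equiv.functor ⋙ BTemp.res S.admissible).Faithful := by
  haveI := S.fullEmbedding_faithful
  infer_instance

/-- **`B^temp(𝒢) ↪ B^temp(Δ)` exists**: there is a fully faithful functor from the tempered coverings of
the graph of anabelioids `𝒢` of the special fibre to the tempered `Δ`-sets (existence form of the two
preceding statements, with `e` the cusp-omission equivalence). [cite: MochizukiSemiAnbd2006, Ex 3.10 p.44] -/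
theorem exists_graphFullEmbedding :
    ∃ F : BTempCat (S.Gc.restrict S.Gc.graph.maximalSubgraph) ⥤ BTemp D.delta, F.Full ∧ F.Faithful := by
  obtain ⟨e⟩ := S.nonempty_btempCat_equivalence_graphOf
  exact ⟨e.symm.functor ⋙ S.chart.equiv.functor ⋙ BTemp.res S.admissible,
    S.graphFullEmbedding_full e.symm, S.graphFullEmbedding_faithful e.symm⟩

end SpecialFibreData

/-! ### The same at every level of a special-fibre tower (p. 269 l. 33 – p. 270 l. 26) -/

namespace SpecialFibreTower

variable {Δ : Type u} [Group Δ] [TopologicalSpace Δ] (T : SpecialFibreTower Δ) (i : ℕ)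

/-- `𝒢^c_i` has no isolated edge (connected with a vertex, field `hyp`).
[cite: MochizukiSemiAnbd2006, Ex 3.10 p.44] -/
theorem not_isIsolatedEdge_Gc (e : (T.Gc i).graph.Edge) : ¬ (T.Gc i).graph.IsIsolatedEdge e :=
  SemiGraph.not_isIsolatedEdge_of_isConnected (T.hyp i).isConnected (T.hyp i).hasVertex e

/-- Deleting the cusps of `𝒢^c_i` — passing to "`𝒢_i` (respectively, `𝒢^c_i`)" (p. 269 l. 33–35) — is a
cusp omission. [cite: MochizukiSemiAnbd2006, Ex 3.10 p.44] -/
theorem maximalSubgraph_isCuspOmission : (T.Gc i).graph.maximalSubgraph.IsCuspOmission :=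
  SemiGraph.maximalSubgraph_isCuspOmission_of_isConnected (T.hyp i).isConnected (T.hyp i).hasVertex

/-- `𝒢_i` is a graph of anabelioids. [cite: MochizukiSemiAnbd2006, Ex 3.10 p.44] -/
theorem isGraph_graphOf : ((T.Gc i).restrict (T.Gc i).graph.maximalSubgraph).IsGraph :=
  SemiGraph.isGraph_maximalSubgraph (T.Gc i).graph

/-- `𝒢_i` is connected. [cite: MochizukiSemiAnbd2006, Ex 3.10 p.44] -/
theorem isConnected_graphOf : ((T.Gc i).restrict (T.Gc i).graph.maximalSubgraph).IsConnected :=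
  SemiGraph.isConnected_maximalSubgraph (T.hyp i).isConnected (T.hyp i).hasVertex

/-- `𝒢_i` has a vertex. [cite: MochizukiSemiAnbd2006, Ex 3.10 p.44] -/
theorem hasVertex_graphOf : ((T.Gc i).restrict (T.Gc i).graph.maximalSubgraph).HasVertex := by
  obtain ⟨v⟩ := (T.hyp i).hasVertex
  exact ⟨(T.maximalSubgraph_isCuspOmission i).vtx v⟩

/-- **`B^temp(𝒢_i) ⥲ B^temp(𝒢^c_i)`** at level `i`: restriction `B^temp(𝒢^c_i) ⥤ B^temp(𝒢_i)` is an
equivalence of categories. [cite: MochizukiSemiAnbd2006, Ex 3.10 p.44] -/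
theorem isEquivalence_btempRestrict_graphOf :
    ((T.Gc i).btempRestrict (T.Gc i).graph.maximalSubgraph).IsEquivalence :=
  ProfiniteSemiGraph.isEquivalence_btempRestrict (T.maximalSubgraph_isCuspOmission i)

/-- `B^temp(𝒢^c_i) ≌ B^temp(𝒢_i)`. [cite: MochizukiSemiAnbd2006, Ex 3.10 p.44] -/
theorem nonempty_btempCat_equivalence_graphOf :
    Nonempty (BTempCat (T.Gc i) ≌ BTempCat ((T.Gc i).restrict (T.Gc i).graph.maximalSubgraph)) :=
  ProfiniteSemiGraph.nonempty_btempCat_equivalence (T.maximalSubgraph_isCuspOmission i)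

/-- **`π₁^temp(𝒢_i) ≅ π₁^temp(𝒢^c_i)`**, temperoid form: `B^temp(𝒢_i) ≌ B^temp(π₁^temp(𝒢^c_i))` for the
level-`i` chart ("`Δ[i] := π₁^temp(𝒢_i) ⋊ Δ_i`", p. 270 l. 25, is built on `π₁^temp(𝒢_i)`).
[cite: MochizukiSemiAnbd2006, Ex 3.10 p.45] -/
theorem nonempty_btempCat_graphOf_equivalence_btemp :
    Nonempty (BTempCat ((T.Gc i).restrict (T.Gc i).graph.maximalSubgraph) ≌ BTemp (T.chart i).G) :=
  ProfiniteSemiGraph.nonempty_btempCat_restrict_equivalence_btemp (T.maximalSubgraph_isCuspOmission i)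
    (T.chart i)

/-- **`π₁^temp(𝒢_i) ≅ π₁^temp(𝒢^c_i)`**, chart form: a tempered fundamental group chart of `𝒢_i` with
the same underlying topological group as the level-`i` chart of `𝒢^c_i`.
[cite: MochizukiSemiAnbd2006, Ex 3.10 p.45] -/
theorem exists_temperedPiChart_graphOf_G_eq :
    ∃ c : TemperedPiChart ((T.Gc i).restrict (T.Gc i).graph.maximalSubgraph), c.G = (T.chart i).G :=
  ProfiniteSemiGraph.exists_temperedPiChart_restrict_G_eq (T.maximalSubgraph_isCuspOmission i)
    (T.chart i)

/-- **`B^temp(𝒢_i) ↪ B^temp(N_i)`** at level `i` (p. 270 l. 23–26 "natural morphisms of temperoids"):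
along any equivalence `e : B^temp(𝒢_i) ≌ B^temp(𝒢^c_i)` the composite with the level-`i` chart and
pull-back along the admissible quotient `N_i ↠ π₁^temp(𝒢_i)` is full.
[cite: MochizukiSemiAnbd2006, Ex 3.10 p.45] -/
theorem graphFullEmbedding_full
    (e : BTempCat ((T.Gc i).restrict (T.Gc i).graph.maximalSubgraph) ≌ BTempCat (T.Gc i)) :
    (e.functor ⋙ (T.chart i).equiv.functor ⋙ BTemp.res (T.adm i)).Full := by
  haveI := T.fullEmbedding_full i
  infer_instance

/-- … and faithful. [cite: MochizukiSemiAnbd2006, Ex 3.10 p.45] -/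
theorem graphFullEmbedding_faithful
    (e : BTempCat ((T.Gc i).restrict (T.Gc i).graph.maximalSubgraph) ≌ BTempCat (T.Gc i)) :
    (e.functor ⋙ (T.chart i).equiv.functor ⋙ BTemp.res (T.adm i)).Faithful := by
  haveI := T.fullEmbedding_faithful i
  infer_instance

/-- A fully faithful functor `B^temp(𝒢_i) ⥤ B^temp(N_i)` exists at every level.
[cite: MochizukiSemiAnbd2006, Ex 3.10 p.45] -/
theorem exists_graphFullEmbedding :
    ∃ F : BTempCat ((T.Gc i).restrict (T.Gc i).graph.maximalSubgraph) ⥤ BTemp (T.N i),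
      F.Full ∧ F.Faithful := by
  obtain ⟨e⟩ := T.nonempty_btempCat_equivalence_graphOf i
  exact ⟨e.symm.functor ⋙ (T.chart i).equiv.functor ⋙ BTemp.res (T.adm i),
    T.graphFullEmbedding_full i e.symm, T.graphFullEmbedding_faithful i e.symm⟩

end SpecialFibreTower

end Literature.AnabelianGeometry.SemiGraphs

end
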